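import Summits.BirchSwinnertonDyer.BirchSwinnertonDyer.Theses.InertBadSignedBranches
import HarnessLib

/-!
# Route `InertBadSignedBranches` (rung K8): the D71 glue `InertBadAtThreeGlue` — the two children of
# the residual crux `InertBadAtThree` (split by the signed local type at `3`) imply the parent

Cell bsd-cm ruling D71 (planner g11, after the referee's FULL PASS on memo N21 v1.2): the `p = 3`
residual `InertBadAtThree` is split into `InertBadAtThreeIstarZero` (the `(3, I₀*)` part, O10-PS@3 —
attacked like `CccOneLawOnTypeIstarZero`) and `InertBadAtThreeOffIstarZero` (off the type: `j = 1728`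
quartic twists, Kodaira III/III* at `3` — residual, CONSTRUCTION). This file lands the glue item
(stmt-BirchSwinnertonDyer-19658): `InertBadAtThreeIstarZero → InertBadAtThreeOffIstarZero →
InertBadAtThree`, a case split on `HasSignedLocalType W 3 (I₀*)` — the planner's sketch
`HOME/bsd-cm-plan/g11/k8split/Sketch.lean` (`InertBadAtThree_of_localType_split`), verbatim (the two
converse directions — each child is implied by the parent — are checked there; genuine pieces, jointly
equivalent). Nothing is asserted: an implication between the route's own items.
[cite: SilvermanATAEC1994, IV.9.4 and Table 4.1] [cite: Miller2011LMS, Def. 1.1]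
-/

set_option autoImplicit false
set_option linter.dupNamespace false

namespace Summit.BirchSwinnertonDyer.BirchSwinnertonDyer.Theorems


/-- **The D71 glue holds**: the `I₀*`-at-3 child and the off-`I₀*`-at-3 child imply `InertBadAtThree`
(case split on the signed local type `(3, I₀*)`; child 1 consumes `hT`, child 2 consumes
`hcm hr hin hng ¬hT`). [cite: SilvermanATAEC1994, IV.9.4 and Table 4.1] [cite: Miller2011LMS, Def. 1.1] -/
theorem inertBadSignedBranches_inertBadAtThreeGlue_proof :
    Summit.BirchSwinnertonDyer.BirchSwinnertonDyer.Theses.InertBadSignedBranches.InertBadAtThreeGlue := by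
  unfold Summit.BirchSwinnertonDyer.BirchSwinnertonDyer.Theses.InertBadSignedBranches.InertBadAtThreeGlue
  intro h₁ h₂ W _ _ _ hcm hr hin hng
  by_cases hT : Summit.BirchSwinnertonDyer.Rank1Residual.X12.O10.HasSignedLocalType W 3 (.Istar 0)
  · exact h₁ W hT hr
  · exact h₂ W hcm hr hin hng hT

end Summit.BirchSwinnertonDyer.BirchSwinnertonDyer.Theorems
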